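import Literature.Analysis.FluidPDE.HardSphereDynamicsProofs
import Literature.MathematicalPhysics.KineticTheory.HardSphereEuler
import Literature.MathematicalPhysics.KineticTheory.BackwardClusterMeasurable
import HarnessLib

/-!
# Speed records on a hard-sphere orbit are set at energetic collisions
# (`stub_energeticCollisionRecord`, registered stub of the birth skeleton of the crux
# `SpeedCapSurgery.MaxSpeedBoundLog`, stmt-AtomisticToContinuum-9629)

Deterministic kinematics of ONE hard-sphere trajectory `γ` (`IsHardSphereTrajectory G ε N γ`,
Gallagher–Saint-Raymond–Texier 2013 Def. 4.1.2): velocities change only at the (locally finitely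
many) collision times (`IsHardSphereTrajectory.free`, `freeFlight` keeps the velocities —
`IsHardSphereTrajectory.vel_eq_of_free`), and at a collision time only the velocities of the
colliding pair `(i, j)` change (`IsHardSphereTrajectory.binary`, `collidePair_apply_of_ne`), the
pre-collisional velocities being those of the preceding free flight
(`IsHardSphereTrajectory.vel_eq_of_tendsto`). Hence:

* `exists_collisionTime_speed_gt` — if every sphere has speed `≤ c` at time `a` and sphere `k` is
  faster than `c` at a time `r ≥ a`, then at the LAST collision time `τ ∈ (a, r]` sphere `k` is
  already faster than `c` (its velocity at `r` is its post-collisional velocity at `τ`);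
* `exists_energetic_collision` — under the same hypotheses (some sphere faster than `c` at some
  `r ∈ [a, t]`), at the FIRST collision time `τ₁ ∈ (a, t]` carrying a sphere faster than `c` the
  colliding pair `(i, j)` has outgoing kinetic energy `‖v_i‖² + ‖v_j‖² > c²`: all velocities of
  the left limit at `τ₁` are `≤ c` (they are the velocities at a time `s₀ ∈ [a, τ₁)` with
  `(s₀, τ₁)` collision-free, and a sphere faster than `c` at `s₀` would produce an earlier fast
  collision time by the first lemma), so the fast sphere at `τ₁` is `i` or `j`, and `0 ≤ c`;
* `stub_energeticCollisionRecord` — the registered stub, verbatim: the previous lemma along the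
  orbit `s ↦ Φ.flow s z` of a good initial datum of a hard-sphere flow on `𝕋³`
  (`HardSphereFlow.isTrajectory`, `HardSphereFlow.flow_zero`), from time `a = 0`.

The two trajectory lemmas are stated for an arbitrary geometry and topological position space
(no Hausdorff / continuity-of-translations hypothesis is needed: limits are taken in velocity
space). No measure theory. References: GST 2013 §4.1 (Def. 4.1.2); Alexander 1975.
-/

noncomputable section

namespace Summit.AtomisticToContinuum.HydrodynamicLimit.Theorems.MaxSpeedBoundLogBirth

open Set Filter Topology
open Literature.Analysis.FluidPDE Literature.MathematicalPhysics.KineticTheory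

variable {d : Type*} [Fintype d] {X : Type*} [TopologicalSpace X] {N : ℕ}
  {G : Geometry d X} {ε : ℝ} {γ : ℝ → Config N d X}

/-- **The last collision before a speed record carries it.** On a hard-sphere trajectory, if every
sphere has speed `≤ c` at time `a` and sphere `k` is faster than `c` at a time `r ≥ a`, then there
is a collision time `τ ∈ (a, r]` at which (post-collisional, right-continuous value) sphere `k`
is faster than `c`: the collision times in `(a, r]` are finitely many
(`IsHardSphereTrajectory.locFinite`); if there is none the velocities at `r` are those at `a`
(`IsHardSphereTrajectory.vel_eq_of_free`), else the velocity of `k` at `r` is its velocity at the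
last one (GST 2013 §4.1). [folklore] -/
theorem exists_collisionTime_speed_gt (h : IsHardSphereTrajectory G ε N γ) {a r c : ℝ}
    (har : a ≤ r) (hslow : ∀ k, ‖(γ a k).2‖ ≤ c) {k : Fin N} (hfast : c < ‖(γ r k).2‖) :
    ∃ τ ∈ Ioc a r, τ ∈ collisionTimes G ε γ ∧ c < ‖(γ τ k).2‖ := by
  classical
  -- the collision times in `(a, r]`
  set F : Finset ℝ := (h.locFinite a r).toFinset.filter fun τ => a < τ with hF
  have hmemF : ∀ τ, τ ∈ F ↔ τ ∈ collisionTimes G ε γ ∧ τ ∈ Ioc a r := by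
    intro τ
    rw [hF, Finset.mem_filter, Set.Finite.mem_toFinset]
    constructor
    · rintro ⟨⟨hcol, hIcc⟩, haτ⟩
      exact ⟨hcol, haτ, hIcc.2⟩
    · rintro ⟨hcol, hIoc⟩
      exact ⟨⟨hcol, hIoc.1.le, hIoc.2⟩, hIoc.1⟩
  rcases F.eq_empty_or_nonempty with hempty | hne
  · -- no collision in `(a, r]`: the velocities at `r` are those at `a`
    exfalso
    have hfree : ∀ τ ∈ Ioc a r, τ ∉ collisionTimes G ε γ := fun τ hτ hcol => by
      have hτF : τ ∈ F := (hmemF τ).2 ⟨hcol, hτ⟩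
      rw [hempty] at hτF
      exact Finset.notMem_empty τ hτF
    rw [h.vel_eq_of_free har hfree k] at hfast
    exact (not_lt.2 (hslow k)) hfast
  · -- the last collision time `τ₀ ∈ (a, r]`; `(τ₀, r]` is collision-free
    obtain ⟨hcol, hIoc⟩ := (hmemF (F.max' hne)).1 (F.max'_mem hne)
    refine ⟨F.max' hne, hIoc, hcol, ?_⟩
    have hfree : ∀ τ ∈ Ioc (F.max' hne) r, τ ∉ collisionTimes G ε γ := fun τ hτ hcol' =>
      (not_le.2 hτ.1) (F.le_max' τ ((hmemF τ).2 ⟨hcol', hIoc.1.trans hτ.1, hτ.2⟩))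
    rwa [h.vel_eq_of_free hIoc.2 hfree k] at hfast

/-- **Speed records are set at energetic collisions.** On a hard-sphere trajectory, if every
sphere has speed `≤ c` at time `a` and some sphere is faster than `c` at some time `r ∈ [a, t]`,
then there is a collision time `τ₁ ∈ (a, t]` whose colliding pair `(i, j)`
(`γ τ₁ ∈ contactSet G N ε i j`) has outgoing kinetic energy `‖v_i(τ₁)‖² + ‖v_j(τ₁)‖² > c²`.
Proof: take the FIRST collision time `τ₁ ∈ (a, t]` at which some sphere is faster than `c`
(there is one by `exists_collisionTime_speed_gt`, and finitely many); write
`γ τ₁ = collidePair G i j zl` with `zl` the left limit (`IsHardSphereTrajectory.binary`); the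
velocities of `zl` are those of `γ s₀` for an `s₀ ∈ [a, τ₁)` with `(s₀, τ₁)` collision-free
(`IsHardSphereTrajectory.exists_Ioo_left_free`, `vel_eq_of_tendsto`), all `≤ c` by minimality of
`τ₁` and the first lemma; `collidePair` moves only `v_i, v_j` (`collidePair_apply_of_ne`), so
the fast sphere is `i` or `j`, and `0 ≤ c` (GST 2013 §4.1 Def. 4.1.2; Alexander 1975). [folklore] -/
theorem exists_energetic_collision (h : IsHardSphereTrajectory G ε N γ) {a t c : ℝ}
    (hslow : ∀ k, ‖(γ a k).2‖ ≤ c) (hfast : ∃ r ∈ Icc a t, ∃ k, c < ‖(γ r k).2‖) :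
    ∃ r ∈ Ioc a t, ∃ i j : Fin N, i ≠ j ∧ γ r ∈ contactSet G N ε i j ∧
      c ^ 2 < ‖(γ r i).2‖ ^ 2 + ‖(γ r j).2‖ ^ 2 := by
  classical
  obtain ⟨r, hr, k₀, hk₀⟩ := hfast
  have hc0 : 0 ≤ c := (norm_nonneg _).trans (hslow k₀)
  -- the finite set of collision times in `(a, t]` carrying a sphere faster than `c`
  set S : Finset ℝ :=
    (h.locFinite a t).toFinset.filter fun τ => a < τ ∧ ∃ k, c < ‖(γ τ k).2‖ with hS
  have hmemS : ∀ τ, τ ∈ S ↔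
      τ ∈ collisionTimes G ε γ ∧ τ ∈ Ioc a t ∧ ∃ k, c < ‖(γ τ k).2‖ := by
    intro τ
    rw [hS, Finset.mem_filter, Set.Finite.mem_toFinset]
    constructor
    · rintro ⟨⟨hcol, hIcc⟩, haτ, hk⟩
      exact ⟨hcol, ⟨haτ, hIcc.2⟩, hk⟩
    · rintro ⟨hcol, hIoc, hk⟩
      exact ⟨⟨hcol, hIoc.1.le, hIoc.2⟩, hIoc.1, hk⟩
  -- `S` is nonempty: the last collision time before `r` carries the fast sphere `k₀`
  obtain ⟨τ, hτ, hτcol, hτfast⟩ := exists_collisionTime_speed_gt h hr.1 hslow hk₀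
  have hSne : S.Nonempty := ⟨τ, (hmemS τ).2 ⟨hτcol, ⟨hτ.1, hτ.2.trans hr.2⟩, k₀, hτfast⟩⟩
  -- the first such time `τ₁` and its minimality
  obtain ⟨hτ₁col, hτ₁Ioc, k₁, hk₁⟩ := (hmemS (S.min' hSne)).1 (S.min'_mem hSne)
  have hmin : ∀ τ' ∈ collisionTimes G ε γ, a < τ' → τ' < S.min' hSne →
      ∀ k, ‖(γ τ' k).2‖ ≤ c := by
    intro τ' hcol' haτ' hlt k
    by_contra hck
    have hmem : τ' ∈ S := (hmemS τ').2 ⟨hcol', ⟨haτ', hlt.le.trans hτ₁Ioc.2⟩, k, not_le.1 hck⟩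
    exact (not_le.2 hlt) (S.min'_le τ' hmem)
  -- the colliding pair and the (pre-collisional) left limit at `τ₁`
  obtain ⟨i, j, hij, hcontact⟩ := hτ₁col
  obtain ⟨-, zl, hzl, -, heq⟩ := h.binary (S.min' hSne) i j hij hcontact
  -- a collision-free interval `(s₀, τ₁)` with `a ≤ s₀ < τ₁`
  obtain ⟨s, hsτ₁, hfree⟩ := h.exists_Ioo_left_free (S.min' hSne)
  have hs₀τ₁ : max s a < S.min' hSne := max_lt hsτ₁ hτ₁Ioc.1
  have hfree₀ : ∀ σ' ∈ Ioo (max s a) (S.min' hSne), σ' ∉ collisionTimes G ε γ :=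
    fun σ' hσ' => hfree σ' ⟨(le_max_left _ _).trans_lt hσ'.1, hσ'.2⟩
  -- the velocities of the left limit are those at `s₀`, all `≤ c` by minimality of `τ₁`
  have hzl_le : ∀ k, ‖(zl k).2‖ ≤ c := by
    intro k
    rw [h.vel_eq_of_tendsto hs₀τ₁ hfree₀ hzl k]
    by_contra hck
    obtain ⟨τ', hτ', hτ'col, hτ'fast⟩ :=
      exists_collisionTime_speed_gt h (le_max_right s a) hslow (not_le.1 hck)
    exact (not_lt.2 (hmin τ' hτ'col hτ'.1 (hτ'.2.trans_lt hs₀τ₁) k)) hτ'fast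
  -- the fast sphere `k₁` at `τ₁` is `i` or `j`: `collidePair` moves no other velocity
  have hk₁ij : k₁ = i ∨ k₁ = j := by
    by_contra hnot
    rw [not_or] at hnot
    rw [heq, collidePair_apply_of_ne hnot.1 hnot.2] at hk₁
    exact (not_lt.2 (hzl_le k₁)) hk₁
  refine ⟨S.min' hSne, hτ₁Ioc, i, j, hij, hcontact, ?_⟩
  have hsq : c ^ 2 < ‖(γ (S.min' hSne) k₁).2‖ ^ 2 := pow_lt_pow_left₀ hk₁ hc0 two_ne_zero
  rcases hk₁ij with rfl | rfl
  · exact hsq.trans_le (le_add_of_nonneg_right (sq_nonneg _))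
  · exact hsq.trans_le (le_add_of_nonneg_left (sq_nonneg _))

/-- **Registered stub `stub_energeticCollisionRecord`** (PATHWISE record lemma, deterministic;
birth skeleton of the crux `SpeedCapSurgery.MaxSpeedBoundLog`, stmt-AtomisticToContinuum-9629,
statement verbatim): on a good orbit of a hard-sphere flow of `N + 1` spheres of diameter
`hsDiameter σ N` on `𝕋³`, if every sphere has speed `≤ c` at time `0` and some sphere has speed
`> c` at some time `r ∈ [0, t]`, then there is a collision time `r' ∈ (0, t]` whose colliding pair
`(i, j)` (`Φ_{r'} z ∈ contactSet i j`) has outgoing kinetic energy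
`‖v_i(r')‖² + ‖v_j(r')‖² > c²`. It is `exists_energetic_collision` for the hard-sphere trajectory
`s ↦ Φ.flow s z` (`HardSphereFlow.isTrajectory`) from time `a = 0`, where `Φ.flow 0 z = z`
(`HardSphereFlow.flow_zero`) (GST 2013 §4.1 Def. 4.1.2; Alexander 1975). [folklore] -/
theorem stub_energeticCollisionRecord :
    ∀ (σ : ℝ) (N : ℕ)
      (Φ : Literature.Analysis.FluidPDE.HardSphereFlow
          (Literature.Analysis.FluidPDE.Torus.geometry (Fin 3))
          (Literature.MathematicalPhysics.KineticTheory.hsDiameter σ N) (N + 1))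
      (z : Literature.Analysis.FluidPDE.Config (N + 1) (Fin 3) Literature.MathematicalPhysics.KineticTheory.T3),
      z ∈ Φ.good → ∀ (c t : ℝ), (∀ i, ‖(z i).2‖ ≤ c) →
      (∃ r ∈ Set.Icc 0 t, ∃ i, c < ‖(Φ.flow r z i).2‖) →
      ∃ r ∈ Set.Ioc 0 t, ∃ i j : Fin (N + 1), i ≠ j ∧
        Φ.flow r z ∈ Literature.Analysis.FluidPDE.contactSet
            (Literature.Analysis.FluidPDE.Torus.geometry (Fin 3)) (N + 1)
            (Literature.MathematicalPhysics.KineticTheory.hsDiameter σ N) i j ∧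
        c ^ 2 < ‖(Φ.flow r z i).2‖ ^ 2 + ‖(Φ.flow r z j).2‖ ^ 2 := by
  intro σ N Φ z hz c t hc0 hfast
  have hslow : ∀ k, ‖((fun s => Φ.flow s z) 0 k).2‖ ≤ c := fun k => by
    show ‖(Φ.flow 0 z k).2‖ ≤ c
    rw [Φ.flow_zero z hz]
    exact hc0 k
  exact exists_energetic_collision (Φ.isTrajectory z hz) hslow hfast

end Summit.AtomisticToContinuum.HydrodynamicLimit.Theorems.MaxSpeedBoundLogBirth

end
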